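import Summits.ResolutionOfSingularities.ResolutionOfSingularities.Theorems.PurelyInseparableDim4JointChartNormalise
import HarnessLib

/-!
# Purely inseparable four-folds: the CHILDREN of a coordinate member through a given comparison `ε`, with model
# descriptions, and their pairwise disjointness — no cover hypothesis (brick S3 (c) «joint point∘coordinate chains»,
# part 37c, cell `res-dim4-pi`; input of the v3-lite step with a three-way cover, part 37d)

[OURS · counted 0] (D-0157 DOOR 2; desk WORD #66 (4)(c), #74 (g), #99 (d); frame `PIDim4.TerminationImpliesOrderReduction`,
S3 (c) v3-lite; host item stmt-ResolutionOfSingularities-16155, helper). Nothing here proves resolution of singularities in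
dimension ≥ 4 / characteristic `p` — NOT here, not anywhere in this programme.

Part 37a's `joint_forest_step_model` WITHOUT the leaf set `L` and the cover hypothesis `hP5` (and hence without the cover and
finiteness conclusions): only the children of the plan entries (part 12's `kid_package_of_iso` through the given `ε`), their
coordinate-member data, their MODEL DESCRIPTIONS, and their pairwise disjointness. The v3-lite step with waiting members needs
the children before it can state its own THREE-WAY cover (children / waiting kids / leaves, part 37d), which part 37a's two-way
`hP5` cannot express (the points of a waiting kid over the host are neither children nor leaves).

* **`joint_forest_kids_model`** — children with data and model descriptions, pairwise disjoint.

AI-produced formalisation, weaker than expert review. bears_on: LADDER-RESOLUTION:D157-DOOR2 (res-dim4-pi · S3 (c) v3-lite).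
-/

set_option linter.dupNamespace false -- D-0017: single-problem summit path `Summit.<S>.<S>.…` by design

noncomputable section

open MvPolynomial Finset CategoryTheory AlgebraicGeometry Opposite TopologicalSpace
open AlgebraicGeometry.Scheme.IdealSheafData (ofIdealTop vanishingIdeal)

namespace Summit.ResolutionOfSingularities.ResolutionOfSingularities.Theorems.PIDim4

open Literature.AlgebraicGeometry.Resolution
open Literature.AlgebraicGeometry.Resolution.Hauser2010
open Literature.AlgebraicGeometry.Resolution.AffinePointBlowup (P A γ coord Wtop ξ)

namespace Equimultiple

section Assembly

variable {K : Type} [Field K] {p : ℕ} [hp : Fact p.Prime] [CharP K p] [DecidableEq K]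
variable {Z Y W Bl : Scheme.{0}} (φ : Y ⟶ Z) [IsOpenImmersion φ] (ψ : Y ⟶ P 4 K) [IsOpenImmersion ψ]
  {π : W ⟶ Z} {B : Bl ⟶ P 4 K} {S : Finset (Fin 4)}
  (ε : (π ⁻¹ᵁ φ.opensRange : Scheme.{0}) ≅ (B ⁻¹ᵁ ψ.opensRange : Scheme.{0}))

/-- **THE CHILDREN OF A COORDINATE MEMBER THROUGH A GIVEN `ε` (no cover hypothesis).** See the module docstring.
[cite: BierstoneGrigorievMilmanWlodarczyk2011, Def. 3.1.3 (1)–(2), (4)] [cite: Hauser2010, §F (equiconstant points)]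
[cite: GortzWedhorn2020, Prop. 13.91] -/
theorem joint_forest_kids_model [IsLocallyNoetherian Z] [IsAlgClosed K] (Zc : Z.IdealSheafData)
    (hπ : IsBlowup π Zc) (hB : IsBlowup B (AffineCoordBlowup.𝓘Λ 4 K (insert 0 (Fin.succ '' (S : Set (Fin 4))))))
    (hsq : ε.hom ≫ (B ∣_ ψ.opensRange) = (π ∣_ φ.opensRange) ≫ (φ.isoOpensRange.inv ≫ ψ.isoOpensRange.hom))
    (hC' : ((AffineCoordBlowup.𝓘Λ 4 K (insert 0 (Fin.succ '' (S : Set (Fin 4))))).comap ψ.opensRange.ι).comap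
        (φ.isoOpensRange.inv ≫ ψ.isoOpensRange.hom) = Zc.comap φ.opensRange.ι)
    (M : MarkedIdeal Z) (hmult : M.mult = p) (s : State K)
    (hK : ((controlledTransform B (AffineCoordBlowup.𝓘Λ 4 K (insert 0 (Fin.succ '' (S : Set (Fin 4)))))
        (hypSheaf p s.F) p).comap (B ⁻¹ᵁ ψ.opensRange).ι).comap ε.hom =
      (controlledTransform π Zc M.ideal p).comap (π ⁻¹ᵁ φ.opensRange).ι) (hS : IsPermissibleCentre p S s.F)
    (hsee : (AffineCoordBlowup.CΛ 4 K (insert 0 (Fin.succ '' (S : Set (Fin 4)))) : Set (P 4 K)) ⊆ Set.range ψ)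
    (hT : IsClosed (φ '' (ψ ⁻¹' (AffineCoordBlowup.CΛ 4 K (insert 0 (Fin.succ '' (S : Set (Fin 4)))) : Set (P 4 K)))))
    (hsncZ : HasSNCWith M.boundary Zc) (idx : Z.IdealSheafData → Fin 4) (cst : Z.IdealSheafData → K)
    (hshape : ∀ D ∈ M.boundary,
      ((D.support : Set Z) ∩ φ '' (ψ ⁻¹'
        (AffineCoordBlowup.CΛ 4 K (insert 0 (Fin.succ '' (S : Set (Fin 4)))) : Set (P 4 K)))).Nonempty →
      D.comap φ = (ofIdealTop (Ideal.span {(γ 4 K).symm (X (idx D).succ + C (cst D))})).comap ψ ∧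
        (idx D ∈ S → cst D = 0))
    (hinj : ∀ D₁ ∈ M.boundary, ∀ D₂ ∈ M.boundary,
      ((D₁.support : Set Z) ∩ φ '' (ψ ⁻¹'
        (AffineCoordBlowup.CΛ 4 K (insert 0 (Fin.succ '' (S : Set (Fin 4)))) : Set (P 4 K)))).Nonempty →
      ((D₂.support : Set Z) ∩ φ '' (ψ ⁻¹'
        (AffineCoordBlowup.CΛ 4 K (insert 0 (Fin.succ '' (S : Set (Fin 4)))) : Set (P 4 K)))).Nonempty →
      idx D₁ = idx D₂ → D₁ = D₂)
    (Pl : Finset (Fin 4 × (Fin 4 → K) × Finset (Fin 4)))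
    (hP1 : ∀ e ∈ Pl, e.1 ∈ S ∧ e.2.1 e.1 = 0 ∧ S ⊆ e.2.2 ∧ CentreBlowup.IsEquimultiplePoint p S e.1 e.2.1 s ∧
      IsPermissibleCentre p e.2.2 (CentreBlowup.step p S e.1 e.2.1 s).F)
    (hP2 : ∀ e ∈ Pl, ∀ e' ∈ Pl, e ≠ e' →
      (e.1 = e'.1 ∧ ∃ i ∈ e.2.2, i ∈ e'.2.2 ∧ e.2.1 i ≠ e'.2.1 i) ∨
      (e.1 ≠ e'.1 ∧ ((e'.2.1 e.1 = 0 ∧ e.1 ∈ e'.2.2) ∨ (e.2.1 e'.1 = 0 ∧ e'.1 ∈ e.2.2)))) :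
    ∃ kid : Fin 4 × (Fin 4 → K) × Finset (Fin 4) → Closeds W,
      (∀ (e : Fin 4 × (Fin 4 → K) × Finset (Fin 4)) (he : e ∈ Pl),
        Scheme.IsRegular (vanishingIdeal (kid e)).subscheme ∧
        HasSNCWith (M.transform π Zc).boundary (vanishingIdeal (kid e)) ∧
        (∃ (Y'' : Scheme.{0}) (φ'' : Y'' ⟶ W) (ψ'' : Y'' ⟶ P 4 K) (_ : IsOpenImmersion φ'') (_ : IsOpenImmersion ψ''),
          (M.transform π Zc).ideal.comap φ'' = (hypSheaf p (CentreBlowup.step p S e.1 e.2.1 s).F).comap ψ'' ∧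
          (vanishingIdeal (kid e)).comap φ'' =
            (AffineCoordBlowup.𝓘Λ 4 K (insert 0 (Fin.succ '' ((e.2.2 : Finset (Fin 4)) : Set (Fin 4))))).comap ψ'' ∧
          (kid e : Set W) ⊆ Set.range φ'' ∧
          (AffineCoordBlowup.CΛ 4 K (insert 0 (Fin.succ '' ((e.2.2 : Finset (Fin 4)) : Set (Fin 4)))) : Set (P 4 K)) ⊆
            Set.range ψ'' ∧
          ∃ (idx₂ : W.IdealSheafData → Fin 4) (cst₂ : W.IdealSheafData → K),
            (∀ D₂ ∈ (M.transform π Zc).boundary,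
              ((D₂.support : Set W) ∩ φ'' '' (ψ'' ⁻¹'
                (AffineCoordBlowup.CΛ 4 K (insert 0 (Fin.succ '' ((e.2.2 : Finset (Fin 4)) : Set (Fin 4)))) :
                  Set (P 4 K)))).Nonempty →
              D₂.comap φ'' = (ofIdealTop (Ideal.span {(γ 4 K).symm (X (idx₂ D₂).succ + C (cst₂ D₂))})).comap ψ'' ∧
                (idx₂ D₂ ∈ e.2.2 → cst₂ D₂ = 0)) ∧
            (∀ D₁ ∈ (M.transform π Zc).boundary, ∀ D₂ ∈ (M.transform π Zc).boundary,
              ((D₁.support : Set W) ∩ φ'' '' (ψ'' ⁻¹'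
                (AffineCoordBlowup.CΛ 4 K (insert 0 (Fin.succ '' ((e.2.2 : Finset (Fin 4)) : Set (Fin 4)))) :
                  Set (P 4 K)))).Nonempty →
              ((D₂.support : Set W) ∩ φ'' '' (ψ'' ⁻¹'
                (AffineCoordBlowup.CΛ 4 K (insert 0 (Fin.succ '' ((e.2.2 : Finset (Fin 4)) : Set (Fin 4)))) :
                  Set (P 4 K)))).Nonempty →
              idx₂ D₁ = idx₂ D₂ → D₁ = D₂)) ∧
        (kid e : Set W) ⊆ π ⁻¹' (φ '' (ψ ⁻¹'
          (AffineCoordBlowup.CΛ 4 K (insert 0 (Fin.succ '' (S : Set (Fin 4)))) : Set (P 4 K)))) ∧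
        (kid e : Set W).Nonempty ∧
        ∃ Θ : A 4 K ≃ₐ[K] A 4 K, (∀ i : Fin 4, Θ (X i.succ) = X i.succ + C (e.2.1 i)) ∧
          (controlledTransform B (AffineCoordBlowup.𝓘Λ 4 K (insert 0 (Fin.succ '' (S : Set (Fin 4))))) (hypSheaf p s.F) p).comap
              (Spec.map (CommRingCat.ofHom (Θ : A 4 K →+* A 4 K)) ≫
                AffineCoordBlowup.chartImm hB (ChartDictionary.succ_mem_centreVars (hP1 e he).1)) =
            hypSheaf p (CentreBlowup.step p S e.1 e.2.1 s).F ∧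
          ∀ (w : W) (hwV : w ∈ π ⁻¹ᵁ φ.opensRange), w ∈ (kid e : Set W) ↔
            ((B ⁻¹ᵁ ψ.opensRange).ι (ε.hom ⟨w, hwV⟩) : Bl) ∈
              (Spec.map (CommRingCat.ofHom (Θ : A 4 K →+* A 4 K)) ≫
                AffineCoordBlowup.chartImm hB (ChartDictionary.succ_mem_centreVars (hP1 e he).1)) ''
                (AffineCoordBlowup.CΛ 4 K (insert 0 (Fin.succ '' ((e.2.2 : Finset (Fin 4)) : Set (Fin 4)))) : Set (P 4 K))) ∧
      (∀ e ∈ Pl, ∀ e' ∈ Pl, e ≠ e' → Disjoint (kid e : Set W) (kid e' : Set W)) := by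
  classical
  haveI : IsProper π := hπ.isProper
  haveI : IsLocallyNoetherian W := LocallyOfFiniteType.isLocallyNoetherian π
  -- the children
  have kidEx := fun (e : Fin 4 × (Fin 4 → K) × Finset (Fin 4)) (he : e ∈ Pl) =>
    kid_package_of_iso φ ψ ε Zc hπ hB hsq hC' M hmult s hK hS.2 hsee hT hsncZ idx cst hshape hinj
      (hP1 e he).1 (hP1 e he).2.1 (hP1 e he).2.2.1
  let kid : Fin 4 × (Fin 4 → K) × Finset (Fin 4) → Closeds W := fun e =>
    if he : e ∈ Pl then (kidEx e he).choose else ⊥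
  have hkid : ∀ e (he : e ∈ Pl), kid e = (kidEx e he).choose := fun e he => dif_pos he
  refine ⟨kid, fun e he => ?_, fun e he e' he' hne => ?_⟩
  · -- data of a child, with its model description
    rw [hkid e he]
    obtain ⟨Θ, hs, hc, hmem, hover, hne, hreg, hsnc, hzig⟩ := (kidEx e he).choose_spec
    exact ⟨hreg, hsnc, hzig, hover, hne, Θ, hs, hc, hmem⟩
  · -- the children are pairwise disjoint
    rw [hkid e he, hkid e' he']
    obtain ⟨Θ, hs, hc, hmem, hover, -⟩ := (kidEx e he).choose_spec
    obtain ⟨Θ', hs', hc', hmem', -, -⟩ := (kidEx e' he').choose_spec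
    have hsR : ∀ k : Fin 4, (Θ : A 4 K →+* A 4 K) (X k.succ) = X k.succ + C (e.2.1 k) := fun k => hs k
    have hsR' : ∀ k : Fin 4, (Θ' : A 4 K →+* A 4 K) (X k.succ) = X k.succ + C (e'.2.1 k) := fun k => hs' k
    have hCR : ∀ c : K, (Θ : A 4 K →+* A 4 K) (C c) = C c := fun c => Θ.commutes c
    have hCR' : ∀ c : K, (Θ' : A 4 K →+* A 4 K) (C c) = C c := fun c => Θ'.commutes c
    rw [Set.disjoint_left]
    intro w hw hw'
    have hwV : w ∈ π ⁻¹ᵁ φ.opensRange := by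
      obtain ⟨y, -, hy⟩ := hover hw
      exact ⟨y, hy⟩
    have h1 := (hmem w hwV).mp hw
    have h2 := (hmem' w hwV).mp hw'
    rcases hP2 e he e' he' hne with ⟨hjj, i, hi, hi', hbi⟩ | ⟨hjj, hcase⟩
    · -- same chart, separated
      obtain ⟨j, b, S''⟩ := e
      obtain ⟨j', b', S'''⟩ := e'
      simp only at hjj hi hi' hbi hsR hsR' h1 h2
      subst hjj
      exact Set.disjoint_left.mp (ChartDictionary.disjoint_image_CΛ_chart_of_ne (hP1 _ he).1 hCR hsR hCR' hsR' hB
        hi hi' hbi) h1 h2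
    · rcases hcase with ⟨hb0, hjS⟩ | ⟨hb0, hjS⟩
      · exact Set.disjoint_left.mp (ChartDictionary.disjoint_image_CΛ_chart_of_ne_chart (hP1 e he).1 (hP1 e' he').1
          hjj hsR' hb0 hB hjS) h1 h2
      · exact Set.disjoint_left.mp (ChartDictionary.disjoint_image_CΛ_chart_of_ne_chart (hP1 e' he').1 (hP1 e he).1
          (Ne.symm hjj) hsR hb0 hB hjS) h2 h1

end Assembly

end Equimultiple

end Summit.ResolutionOfSingularities.ResolutionOfSingularities.Theorems.PIDim4

end
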